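import Summits.CriticalPhenomena.PercolationContinuityZ3.Theorems.PercNearOneGluingNoHeavyLowerTailSahiTwoChainCaps
import HarnessLib

/-!
# Sahi positivity of every order for ALL increasing events of the root cluster of a cycle (unions of caps)

Support file for the Sahi programme (`--supports stmt-CriticalPhenomena-4575`, prover prim-sahi-p2 gen 9).
No definitions, no named facts, no sorries; standard axioms.  Memo `…/prim-sahi-p2/PROOF-E3.md` §20g.
Sequel of `…SahiTwoChainCaps.lean` (caps `⋂_{t∈U}(R t ∪ L t)` of an antitone chain `R` and a monotone chain `L`
with `R v ⊥ L v'` for `v ≤ v'`).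

**Theorem `sahiE_nonneg_of_twoChainCupCaps`.**  Under the same hypotheses, every family of FINITE UNIONS OF CAPS
`A_i = ⋃_{U ∈ 𝒰_i} ⋂_{t∈U}(R t ∪ L t)` has `E_n ≥ 0`.  On a weighted cycle (with `R`, `L` the two arcs) these are
exactly the increasing events of the root cluster `C_0` (an up-set of subsets is the union of the principal
events of its minimal elements) — instantiated in the sibling file `…SahiUpperClusterCycle.lean`.

**Proof.**  `1_{A ∪ cap U} = 1_A + 1_{cap U} − 1_A·1_{cap U}` and caps are closed under intersection, so every
product of union-of-cap indicators is a signed combination `Σ_j c_j 1_{cap U_j}` with the SAME coefficients in the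
real system and in the model system (product of the two level laws); cap probabilities agree
(`TwoChainCaps.ex_ind_cap_congr`), hence all product moments agree, and in the model the unions of caps are
increasing events on a product of two chains (Lieb–Sahi, tree `ProductChains.sahiPositive_prodWeight_linearOrder`).
-/

noncomputable section

namespace Summit.CriticalPhenomena.PercolationContinuityZ3.Theorems

namespace TwoChainCaps

open Finset Literature.Combinatorics.Sahi2008
open Literature.Probability.Percolation.DecisionTree (ind ind_of_mem ind_of_not_mem ind_nonneg)
open scoped Classical

variable {α β : Type*} [Fintype α] [Fintype β] {m : ℕ}

/-! ### Indicator plumbing -/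

omit [Fintype α] in
/-- Caps are closed under intersection: `1_{cap U} · 1_{cap V} = 1_{cap (U ∪ V)}`. [folklore] -/
theorem ind_cap_mul_ind_cap (R L : Fin m → Set α) (U V : Finset (Fin m)) :
    ind (⋂ t ∈ U, (R t ∪ L t)) * ind (⋂ t ∈ V, (R t ∪ L t)) = ind (⋂ t ∈ U ∪ V, (R t ∪ L t)) := by
  rw [Finset.set_biInter_inter]
  funext x
  exact (Literature.Probability.Percolation.BHK2006.ind_inter _ _ x).symm

omit [Fintype α] in
/-- `1_{A ∪ B} = 1_A + 1_B − 1_A 1_B`. [folklore] -/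
private theorem ind_union_eq (A B : Set α) : ind (A ∪ B) = ind A + ind B - ind A * ind B := by
  funext x
  simp only [Pi.add_apply, Pi.sub_apply, Pi.mul_apply]
  by_cases hA : x ∈ A
  · rw [ind_of_mem (Set.mem_union_left B hA), ind_of_mem hA]
    by_cases hB : x ∈ B
    · rw [ind_of_mem hB]; ring
    · rw [ind_of_not_mem hB]; ring
  · rw [ind_of_not_mem hA]
    by_cases hB : x ∈ B
    · rw [ind_of_mem (Set.mem_union_right A hB), ind_of_mem hB]; ring
    · rw [ind_of_not_mem (fun h => h.elim hA hB), ind_of_not_mem hB]; ring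

omit [Fintype β] in
/-- `E(Σ_j c_j g_j) = Σ_j c_j E(g_j)` (plumbing). [folklore] -/
private theorem ex_sum_mul {k : ℕ} (μ : α → ℝ) (c : Fin k → ℝ) (g : Fin k → α → ℝ) :
    ex μ (fun x => ∑ j, c j * g j x) = ∑ j, c j * ex μ (g j) := by
  simp only [ex_def, Finset.mul_sum]
  rw [Finset.sum_comm]
  refine Finset.sum_congr rfl fun j _ => Finset.sum_congr rfl fun x _ => ?_
  ring

/-! ### The theorem -/

/-- **Sahi positivity of every order for finite unions of caps of two independent chains** (all increasing
events of the root cluster of a cycle).  Hypotheses as in `sahiE_nonneg_of_twoChainCaps`; events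
`A_i = ⋃_{U∈𝒰_i} ⋂_{t∈U}(R t ∪ L t)`. [this work] -/
theorem sahiE_nonneg_of_twoChainCupCaps (μ : α → ℝ) (hμ0 : ∀ x, 0 ≤ μ x) (hμ1 : ∑ x, μ x = 1)
    (R L : Fin m → Set α)
    (hR : ∀ ⦃v v' : Fin m⦄, v ≤ v' → R v' ⊆ R v) (hL : ∀ ⦃v v' : Fin m⦄, v ≤ v' → L v ⊆ L v')
    (hind : ∀ v v' : Fin m, v ≤ v' → ex μ (ind (R v) * ind (L v')) = ex μ (ind (R v)) * ex μ (ind (L v')))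
    (n : ℕ) (𝒰 : Fin n → Finset (Finset (Fin m))) :
    0 ≤ sahiE μ n (fun i => ind (⋃ U ∈ 𝒰 i, ⋂ t ∈ U, (R t ∪ L t))) := by
  -- the two chain levels and the model (as in `sahiE_nonneg_of_twoChainCaps`)
  let ρ : α → Fin (m + 1) := fun x =>
    ⟨(univ.filter fun k : Fin m => x ∈ R k).card,
      Nat.lt_succ_of_le ((card_filter_le _ _).trans (by rw [Finset.card_fin]))⟩
  let lam : α → Fin (m + 1) := fun x =>
    ⟨(univ.filter fun k : Fin m => x ∈ L k).card,
      Nat.lt_succ_of_le ((card_filter_le _ _).trans (by rw [Finset.card_fin]))⟩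
  have hρ : ∀ x (k : Fin m), x ∈ R k ↔ k.val < (ρ x).val := by
    intro x k
    have h := TwoChainUnions.mem_iff_lt_card_of_lower (D := univ.filter fun k : Fin m => x ∈ R k)
      (fun k k' hkk' hk => by
        simp only [mem_filter, mem_univ, true_and] at hk ⊢
        exact hR hkk' hk) k
    simpa only [mem_filter, mem_univ, true_and] using h
  have hlam : ∀ x (k : Fin m), x ∈ L k ↔ m - (lam x).val ≤ k.val := by
    intro x k
    have h := TwoChainUnions.mem_iff_sub_card_le_of_upper (U := univ.filter fun k : Fin m => x ∈ L k)
      (fun k k' hkk' hk => by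
        simp only [mem_filter, mem_univ, true_and] at hk ⊢
        exact hL hkk' hk) k
    simpa only [mem_filter, mem_univ, true_and] using h
  let w₁ : Fin (m + 1) → ℝ := pushWeight μ ρ
  let w₂ : Fin (m + 1) → ℝ := pushWeight μ lam
  let W : Fin (m + 1) × Fin (m + 1) → ℝ := fun p => w₁ p.1 * w₂ p.2
  let R' : Fin m → Set (Fin (m + 1) × Fin (m + 1)) := fun v => {p | v.val < p.1.val}
  let L' : Fin m → Set (Fin (m + 1) × Fin (m + 1)) := fun v => {p | m - p.2.val ≤ v.val}
  have hW1 : ∑ p, W p = 1 := by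
    simp only [W]
    rw [Fintype.sum_prod_type, ← Finset.sum_mul_sum]
    simp only [w₁, w₂, sum_pushWeight, hμ1, mul_one]
  have hR' : ∀ ⦃v v' : Fin m⦄, v ≤ v' → R' v' ⊆ R' v :=
    fun v v' h p hp => lt_of_le_of_lt (Fin.le_def.1 h) hp
  have hL' : ∀ ⦃v v' : Fin m⦄, v ≤ v' → L' v ⊆ L' v' :=
    fun v v' h p hp => le_trans hp (Fin.le_def.1 h)
  let F₁ : Fin m → Fin (m + 1) → ℝ := fun v r => if v.val < r.val then 1 else 0
  let F₂ : Fin m → Fin (m + 1) → ℝ := fun v l => if m - l.val ≤ v.val then 1 else 0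
  have hF₁ : ∀ v, ind (R' v) = fun p : Fin (m + 1) × Fin (m + 1) => F₁ v p.1 * (1 : Fin (m + 1) → ℝ) p.2 := by
    intro v; funext p
    simp only [F₁, Pi.one_apply, mul_one]
    by_cases h : v.val < p.1.val
    · rw [if_pos h]; exact ind_of_mem h
    · rw [if_neg h]; exact ind_of_not_mem h
  have hF₂ : ∀ v, ind (L' v) = fun p : Fin (m + 1) × Fin (m + 1) => (1 : Fin (m + 1) → ℝ) p.1 * F₂ v p.2 := by
    intro v; funext p
    simp only [F₂, Pi.one_apply, one_mul]
    by_cases h : m - p.2.val ≤ v.val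
    · rw [if_pos h]; exact ind_of_mem h
    · rw [if_neg h]; exact ind_of_not_mem h
  have hF₁₂ : ∀ v v', ind (R' v) * ind (L' v') =
      fun p : Fin (m + 1) × Fin (m + 1) => F₁ v p.1 * F₂ v' p.2 := by
    intro v v'; funext p
    rw [Pi.mul_apply, hF₁, hF₂]
    simp only [Pi.one_apply, mul_one, one_mul]
  have hw₁1 : ex w₁ (1 : Fin (m + 1) → ℝ) = 1 := ex_one (by simp only [w₁, sum_pushWeight, hμ1])
  have hw₂1 : ex w₂ (1 : Fin (m + 1) → ℝ) = 1 := ex_one (by simp only [w₂, sum_pushWeight, hμ1])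
  have hexR' : ∀ v, ex W (ind (R' v)) = ex w₁ (F₁ v) := by
    intro v; rw [hF₁, TwoChainUnions.ex_prodWeight_mul w₁ w₂ (F₁ v) 1, hw₂1, mul_one]
  have hexL' : ∀ v, ex W (ind (L' v)) = ex w₂ (F₂ v) := by
    intro v; rw [hF₂, TwoChainUnions.ex_prodWeight_mul w₁ w₂ 1 (F₂ v), hw₁1, one_mul]
  have hind' : ∀ v v' : Fin m, v ≤ v' →
      ex W (ind (R' v) * ind (L' v')) = ex W (ind (R' v)) * ex W (ind (L' v')) := by
    intro v v' _
    rw [hF₁₂, TwoChainUnions.ex_prodWeight_mul w₁ w₂ (F₁ v) (F₂ v'), hexR', hexL']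
  have ha : ∀ v, ex μ (ind (R v)) = ex W (ind (R' v)) := by
    intro v
    rw [hexR', show w₁ = pushWeight μ ρ from rfl, ex_pushWeight]
    congr 1
    funext x
    simp only [Function.comp_apply, F₁]
    by_cases hx : x ∈ R v
    · rw [ind_of_mem hx, if_pos ((hρ x v).1 hx)]
    · rw [ind_of_not_mem hx, if_neg (fun h => hx ((hρ x v).2 h))]
  have hb : ∀ v, ex μ (ind (L v)) = ex W (ind (L' v)) := by
    intro v
    rw [hexL', show w₂ = pushWeight μ lam from rfl, ex_pushWeight]
    congr 1
    funext x
    simp only [Function.comp_apply, F₂]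
    by_cases hx : x ∈ L v
    · rw [ind_of_mem hx, if_pos ((hlam x v).1 hx)]
    · rw [ind_of_not_mem hx, if_neg (fun h => hx ((hlam x v).2 h))]
  -- cap probabilities agree
  have hcap : ∀ U : Finset (Fin m),
      ex μ (ind (⋂ t ∈ U, (R t ∪ L t))) = ex W (ind (⋂ t ∈ U, (R' t ∪ L' t))) :=
    fun U => (ex_ind_cap_congr μ W hμ1 hW1 R L R' L' hR hL hR' hL' hind hind' ha hb U).1
  -- representable pairs: the same signed combination of caps on both sides
  -- (closure under subtraction/addition and under multiplication by a cap; then by a union of caps)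
  have key : ∀ (𝒱 : Finset (Finset (Fin m))) (k : ℕ) (c : Fin k → ℝ) (U : Fin k → Finset (Fin m)),
      ∃ (k' : ℕ) (c' : Fin k' → ℝ) (U' : Fin k' → Finset (Fin m)),
        (fun x => ∑ j, c j * ind (⋂ t ∈ U j, (R t ∪ L t)) x) * ind (⋃ V ∈ 𝒱, ⋂ t ∈ V, (R t ∪ L t)) =
            (fun x => ∑ j, c' j * ind (⋂ t ∈ U' j, (R t ∪ L t)) x) ∧
          (fun p => ∑ j, c j * ind (⋂ t ∈ U j, (R' t ∪ L' t)) p) * ind (⋃ V ∈ 𝒱, ⋂ t ∈ V, (R' t ∪ L' t)) =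
            (fun p => ∑ j, c' j * ind (⋂ t ∈ U' j, (R' t ∪ L' t)) p) := by
    intro 𝒱
    induction 𝒱 using Finset.induction_on with
    | empty =>
      intro k c U
      refine ⟨0, Fin.elim0, Fin.elim0, ?_, ?_⟩
      · funext x
        simp only [Pi.mul_apply, Finset.notMem_empty, Set.iUnion_of_empty, Set.iUnion_empty,
          Finset.univ_eq_empty, Finset.sum_empty]
        rw [ind_of_not_mem (Set.notMem_empty x), mul_zero]
      · funext p
        simp only [Pi.mul_apply, Finset.notMem_empty, Set.iUnion_of_empty, Set.iUnion_empty,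
          Finset.univ_eq_empty, Finset.sum_empty]
        rw [ind_of_not_mem (Set.notMem_empty p), mul_zero]
    | insert V 𝒱 hV ih =>
      intro k c U
      -- g·1_{cap V ∪ A} = g 1_V + g 1_A − (g 1_V) 1_A
      obtain ⟨k₁, c₁, U₁, h₁α, h₁β⟩ := ih k c U
      obtain ⟨k₂, c₂, U₂, h₂α, h₂β⟩ := ih k c (fun j => U j ∪ V)
      refine ⟨k + k₁ + k₂, Fin.append (Fin.append c c₁) (fun j => -c₂ j),
        Fin.append (Fin.append (fun j => U j ∪ V) U₁) U₂, ?_, ?_⟩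
      · funext x
        rw [Finset.set_biUnion_insert, Pi.mul_apply, ind_union_eq]
        simp only [Pi.add_apply, Pi.sub_apply, Pi.mul_apply]
        have e₁ := congrFun h₁α x
        have e₂ := congrFun h₂α x
        simp only [Pi.mul_apply] at e₁ e₂
        have ecap : ∀ j, ind (⋂ t ∈ U j, (R t ∪ L t)) x * ind (⋂ t ∈ V, (R t ∪ L t)) x =
            ind (⋂ t ∈ U j ∪ V, (R t ∪ L t)) x := fun j => by
          have := congrFun (ind_cap_mul_ind_cap R L (U j) V) x
          simpa only [Pi.mul_apply] using this
        rw [Fin.sum_univ_add, Fin.sum_univ_add]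
        simp only [Fin.append_left, Fin.append_right]
        have hgV : (∑ j, c j * ind (⋂ t ∈ U j, (R t ∪ L t)) x) * ind (⋂ t ∈ V, (R t ∪ L t)) x =
            ∑ j, c j * ind (⋂ t ∈ U j ∪ V, (R t ∪ L t)) x := by
          rw [Finset.sum_mul]
          exact Finset.sum_congr rfl fun j _ => by rw [mul_assoc, ecap j]
        -- (g)(1_V + 1_A - 1_V 1_A) = g 1_V + g 1_A - (g 1_V) 1_A
        have hgVA : (∑ j, c j * ind (⋂ t ∈ U j ∪ V, (R t ∪ L t)) x) *
            ind (⋃ V' ∈ 𝒱, ⋂ t ∈ V', (R t ∪ L t)) x = ∑ j, c₂ j * ind (⋂ t ∈ U₂ j, (R t ∪ L t)) x := e₂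
        calc (∑ j, c j * ind (⋂ t ∈ U j, (R t ∪ L t)) x) *
              (ind (⋂ t ∈ V, (R t ∪ L t)) x + ind (⋃ V' ∈ 𝒱, ⋂ t ∈ V', (R t ∪ L t)) x -
                ind (⋂ t ∈ V, (R t ∪ L t)) x * ind (⋃ V' ∈ 𝒱, ⋂ t ∈ V', (R t ∪ L t)) x)
            = (∑ j, c j * ind (⋂ t ∈ U j, (R t ∪ L t)) x) * ind (⋂ t ∈ V, (R t ∪ L t)) x +
              (∑ j, c j * ind (⋂ t ∈ U j, (R t ∪ L t)) x) * ind (⋃ V' ∈ 𝒱, ⋂ t ∈ V', (R t ∪ L t)) x -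
              ((∑ j, c j * ind (⋂ t ∈ U j, (R t ∪ L t)) x) * ind (⋂ t ∈ V, (R t ∪ L t)) x) *
                ind (⋃ V' ∈ 𝒱, ⋂ t ∈ V', (R t ∪ L t)) x := by ring
          _ = (∑ j, c j * ind (⋂ t ∈ U j ∪ V, (R t ∪ L t)) x) +
              (∑ j, c₁ j * ind (⋂ t ∈ U₁ j, (R t ∪ L t)) x) +
              ∑ j, -c₂ j * ind (⋂ t ∈ U₂ j, (R t ∪ L t)) x := by
            rw [hgV, e₁, hgVA, sub_eq_add_neg, ← Finset.sum_neg_distrib]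
            refine congrArg₂ (· + ·) rfl (Finset.sum_congr rfl fun j _ => by ring)
      · funext p
        rw [Finset.set_biUnion_insert, Pi.mul_apply, ind_union_eq]
        simp only [Pi.add_apply, Pi.sub_apply, Pi.mul_apply]
        have e₁ := congrFun h₁β p
        have e₂ := congrFun h₂β p
        simp only [Pi.mul_apply] at e₁ e₂
        have ecap : ∀ j, ind (⋂ t ∈ U j, (R' t ∪ L' t)) p * ind (⋂ t ∈ V, (R' t ∪ L' t)) p =
            ind (⋂ t ∈ U j ∪ V, (R' t ∪ L' t)) p := fun j => by
          have := congrFun (ind_cap_mul_ind_cap R' L' (U j) V) p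
          simpa only [Pi.mul_apply] using this
        rw [Fin.sum_univ_add, Fin.sum_univ_add]
        simp only [Fin.append_left, Fin.append_right]
        have hgV : (∑ j, c j * ind (⋂ t ∈ U j, (R' t ∪ L' t)) p) * ind (⋂ t ∈ V, (R' t ∪ L' t)) p =
            ∑ j, c j * ind (⋂ t ∈ U j ∪ V, (R' t ∪ L' t)) p := by
          rw [Finset.sum_mul]
          exact Finset.sum_congr rfl fun j _ => by rw [mul_assoc, ecap j]
        have hgVA : (∑ j, c j * ind (⋂ t ∈ U j ∪ V, (R' t ∪ L' t)) p) *
            ind (⋃ V' ∈ 𝒱, ⋂ t ∈ V', (R' t ∪ L' t)) p = ∑ j, c₂ j * ind (⋂ t ∈ U₂ j, (R' t ∪ L' t)) p := e₂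
        calc (∑ j, c j * ind (⋂ t ∈ U j, (R' t ∪ L' t)) p) *
              (ind (⋂ t ∈ V, (R' t ∪ L' t)) p + ind (⋃ V' ∈ 𝒱, ⋂ t ∈ V', (R' t ∪ L' t)) p -
                ind (⋂ t ∈ V, (R' t ∪ L' t)) p * ind (⋃ V' ∈ 𝒱, ⋂ t ∈ V', (R' t ∪ L' t)) p)
            = (∑ j, c j * ind (⋂ t ∈ U j, (R' t ∪ L' t)) p) * ind (⋂ t ∈ V, (R' t ∪ L' t)) p +
              (∑ j, c j * ind (⋂ t ∈ U j, (R' t ∪ L' t)) p) * ind (⋃ V' ∈ 𝒱, ⋂ t ∈ V', (R' t ∪ L' t)) p -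
              ((∑ j, c j * ind (⋂ t ∈ U j, (R' t ∪ L' t)) p) * ind (⋂ t ∈ V, (R' t ∪ L' t)) p) *
                ind (⋃ V' ∈ 𝒱, ⋂ t ∈ V', (R' t ∪ L' t)) p := by ring
          _ = (∑ j, c j * ind (⋂ t ∈ U j ∪ V, (R' t ∪ L' t)) p) +
              (∑ j, c₁ j * ind (⋂ t ∈ U₁ j, (R' t ∪ L' t)) p) +
              ∑ j, -c₂ j * ind (⋂ t ∈ U₂ j, (R' t ∪ L' t)) p := by
            rw [hgV, e₁, hgVA, sub_eq_add_neg, ← Finset.sum_neg_distrib]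
            refine congrArg₂ (· + ·) rfl (Finset.sum_congr rfl fun j _ => by ring)
  -- every product of union-of-cap indicators is representable, starting from the constant `1 = 1_{cap ∅}`
  have hprod : ∀ S : Finset (Fin n), ∃ (k : ℕ) (c : Fin k → ℝ) (U : Fin k → Finset (Fin m)),
      (∏ i ∈ S, ind (⋃ V ∈ 𝒰 i, ⋂ t ∈ V, (R t ∪ L t))) =
          (fun x => ∑ j, c j * ind (⋂ t ∈ U j, (R t ∪ L t)) x) ∧
        (∏ i ∈ S, ind (⋃ V ∈ 𝒰 i, ⋂ t ∈ V, (R' t ∪ L' t))) =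
          (fun p => ∑ j, c j * ind (⋂ t ∈ U j, (R' t ∪ L' t)) p) := by
    intro S
    induction S using Finset.induction_on with
    | empty =>
      refine ⟨1, fun _ => 1, fun _ => ∅, ?_, ?_⟩
      · funext x
        rw [Finset.prod_empty]
        simp only [Finset.univ_unique, Finset.sum_singleton, one_mul, Finset.notMem_empty,
          Set.iInter_of_empty, Set.iInter_univ, Pi.one_apply]
        exact (ind_of_mem (Set.mem_univ x)).symm
      · funext p
        rw [Finset.prod_empty]
        simp only [Finset.univ_unique, Finset.sum_singleton, one_mul, Finset.notMem_empty,
          Set.iInter_of_empty, Set.iInter_univ, Pi.one_apply]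
        exact (ind_of_mem (Set.mem_univ p)).symm
    | insert i S hi ih =>
      obtain ⟨k, c, U, hα, hβ⟩ := ih
      obtain ⟨k', c', U', hα', hβ'⟩ := key (𝒰 i) k c U
      refine ⟨k', c', U', ?_, ?_⟩
      · rw [Finset.prod_insert hi, mul_comm, hα]; exact hα'
      · rw [Finset.prod_insert hi, mul_comm, hβ]; exact hβ'
  -- model positivity: unions of caps are increasing events on a product of two chains
  have hcapup : ∀ U : Finset (Fin m), IsUpperSet (⋂ t ∈ U, (R' t ∪ L' t)) := by
    intro U
    refine isUpperSet_iInter₂ fun t _ => IsUpperSet.union ?_ ?_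
    · intro p q hpq hp
      exact lt_of_lt_of_le hp (Fin.le_def.1 (Prod.mk_le_mk.1 hpq).1)
    · intro p q hpq hp
      have := Fin.le_def.1 (Prod.mk_le_mk.1 hpq).2
      exact le_trans (Nat.sub_le_sub_left this m) hp
  have hup : ∀ i, IsUpperSet (⋃ V ∈ 𝒰 i, ⋂ t ∈ V, (R' t ∪ L' t)) :=
    fun i => isUpperSet_iUnion₂ fun V _ => hcapup V
  have hmono : ∀ i, Monotone (ind (⋃ V ∈ 𝒰 i, ⋂ t ∈ V, (R' t ∪ L' t))) := by
    intro i p q hpq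
    by_cases hp : p ∈ ⋃ V ∈ 𝒰 i, ⋂ t ∈ V, (R' t ∪ L' t)
    · rw [ind_of_mem hp, ind_of_mem (hup i hpq hp)]
    · rw [ind_of_not_mem hp]; exact ind_nonneg _ q
  have hmodel : 0 ≤ sahiE W n (fun i => ind (⋃ V ∈ 𝒰 i, ⋂ t ∈ V, (R' t ∪ L' t))) :=
    ProductChains.sahiPositive_prodWeight_linearOrder w₁ w₂ (pushWeight_nonneg hμ0 _)
      (by rw [sum_pushWeight, hμ1]) (pushWeight_nonneg hμ0 _) (by rw [sum_pushWeight, hμ1]) n _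
      (fun i p => ind_nonneg _ p) hmono
  -- transfer
  rw [TwoChainUnions.sahiE_congr_of_prodMoments μ W n (fun i => ind (⋃ V ∈ 𝒰 i, ⋂ t ∈ V, (R t ∪ L t)))
    (fun i => ind (⋃ V ∈ 𝒰 i, ⋂ t ∈ V, (R' t ∪ L' t))) fun S => ?_]
  · exact hmodel
  obtain ⟨k, c, U, hα, hβ⟩ := hprod S
  rw [hα, hβ, ex_sum_mul, ex_sum_mul]
  exact Finset.sum_congr rfl fun j _ => by rw [hcap (U j)]

end TwoChainCaps


end Summit.CriticalPhenomena.PercolationContinuityZ3.Theorems
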